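import Summits.ValiantsHypothesis.ValiantsHypothesis.Theorems.SymPencilPerFourOneRowEndgame

/-!
# Route `SymPencil` — the one-row kernel cell at defect two: the ENDGAME from the abstract flow
# identities, given hyperplane flow rigidity (`--supports` stmt-ValiantsHypothesis-5674; rung
# currency for `sdc(per_4)`, size-`27` cell `(12,4,2)`; nothing here bears on `VP ≠ VNP`)

Abstract data (produced from the base-point package by
`SymPencilPerFourOneRowDefectTwoKernel.exists_flow_identities`): `U = K^{3×4} × K`, a family of
bilinear forms `Γ_x` on `U` depending linearly on `x ∈ K^{3×4}`, a linear map `M : U → U`, constants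
`δ₀, c ≠ 0`, a base row `v`, and, with `F_v(x) = per [v; x 0; x 1; x 2]`,

* (flow) `u + t M u = (x, 0) ⟹ δ₀ Γ_x(u, u) = c t F_v(x)`,
* (E1)   `2 δ₀ Γ_x(M(x,0), (x,0)) = - c F_v(x)`.

Write `M (y, 0) = (K y, λ y)`.  Taking `u = (y, 0)` with `λ y = 0` and `x = y + t K y` in (flow)
gives `δ₀ t Γ_{Ky}((y,0),(y,0)) = c t F_v(y + t K y)` for all `t`, whence (Vandermonde at
`t = ±1, ±2`) the EXACT FLOW `F_v(y + t K y) = F_v(y)` on the hyperplane `ker λ`.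

**Theorem** (`false_of_flow_identities`).  If the base row `v` has the HYPERPLANE FLOW RIGIDITY
property — every linear `X` and linear form `ℓ` on `K^{3×4}` with `F_v(y + t X y) = F_v(y)` for all
`y ∈ ker ℓ` and all `t` admit a point `y ∈ ker ℓ` with `X y = 0` and `F_v(y) ≠ 0` — then the data
above do not exist: at such a point (E1) reads `0 = - c F_v(y)`.  The rigidity property (for
`v = 𝟙`) is the one remaining piece of the cell `(12,4,2)`; for `ℓ = 0` it is the Lie-stabiliser
theorem `SymPencilPerFourRowStabilizer.rowScaling_of_deriv_vanish` plus a point with `F_v ≠ 0`.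
Elementary; no definitions, no named facts. [folklore]
-/

noncomputable section

-- single-conjunct layout: Sub = Summit, duplicated namespace component intended
set_option linter.dupNamespace false

namespace Summit.ValiantsHypothesis.ValiantsHypothesis.Theorems.SymPencilPerFourOneRowDefectTwoEndgame

open Matrix Module
open Summit.ValiantsHypothesis.ValiantsHypothesis.Theorems.SymPencilPerFourOneRowEndgame

variable {K : Type*} [Field K] [CharZero K]

/-- **Exact flow from the abstract flow identity.**  If `δ₀ t g = c t F(t)` for all `t` with
`F(t) = P₀ + t P₁ + t² P₂ + t³ P₃` and `c ≠ 0`, then `P₁ = P₂ = P₃ = 0` (and `δ₀ g = c P₀`).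
[folklore] -/
theorem cubic_coeffs_eq_zero {δ₀ c g P₀ P₁ P₂ P₃ : K} (hc : c ≠ 0)
    (h : ∀ t : K, δ₀ * t * g = c * t * (P₀ + t * P₁ + t ^ 2 * P₂ + t ^ 3 * P₃)) :
    P₁ = 0 ∧ P₂ = 0 ∧ P₃ = 0 := by
  have h1 := h 1
  have h2 := h (-1)
  have h3 := h 2
  have h4 := h (-2)
  have e3 : (24 : K) * (c * P₃) = 0 := by linear_combination -h3 - h4 + 4 * h1 + 4 * h2
  have hP₃ : P₃ = 0 := by
    rcases mul_eq_zero.1 e3 with h | h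
    · norm_num at h
    · exact (mul_eq_zero.1 h).resolve_left hc
  have e1 : (2 : K) * (c * P₁) = 0 := by linear_combination -h1 - h2 - 2 * c * hP₃
  have hP₁ : P₁ = 0 := by
    rcases mul_eq_zero.1 e1 with h | h
    · norm_num at h
    · exact (mul_eq_zero.1 h).resolve_left hc
  have e2 : (12 : K) * (c * P₂) = 0 := by linear_combination -h3 + h4 + 2 * h1 - 2 * h2
  have hP₂ : P₂ = 0 := by
    rcases mul_eq_zero.1 e2 with h | h
    · norm_num at h
    · exact (mul_eq_zero.1 h).resolve_left hc
  exact ⟨hP₁, hP₂, hP₃⟩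

/-- **The defect-two endgame, given hyperplane flow rigidity of the base row.**  See the module
docstring. [folklore] -/
theorem false_of_flow_identities (v : Fin 4 → K)
    (Γ : (Fin 3 → Fin 4 → K) →ₗ[K]
      ((Fin 3 → Fin 4 → K) × K) →ₗ[K] ((Fin 3 → Fin 4 → K) × K) →ₗ[K] K)
    (M : ((Fin 3 → Fin 4 → K) × K) →ₗ[K] ((Fin 3 → Fin 4 → K) × K))
    {δ₀ c : K} (hδ₀ : δ₀ ≠ 0) (hc : c ≠ 0)
    (hflow : ∀ (x : Fin 3 → Fin 4 → K) (t : K) (u : (Fin 3 → Fin 4 → K) × K),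
      u + t • M u = (x, 0) →
        δ₀ * Γ x u u = c * t * (Matrix.of ![v, x 0, x 1, x 2]).permanent)
    (hE1 : ∀ x : Fin 3 → Fin 4 → K,
      2 * δ₀ * Γ x (M (x, 0)) (x, 0) = -(c * (Matrix.of ![v, x 0, x 1, x 2]).permanent))
    (hrig : ∀ (X : (Fin 3 → Fin 4 → K) →ₗ[K] (Fin 3 → Fin 4 → K))
      (ℓ : (Fin 3 → Fin 4 → K) →ₗ[K] K),
      (∀ y, ℓ y = 0 → ∀ t : K,
        (Matrix.of ![v, (y + t • X y) 0, (y + t • X y) 1, (y + t • X y) 2]).permanent =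
          (Matrix.of ![v, y 0, y 1, y 2]).permanent) →
      ∃ y, ℓ y = 0 ∧ X y = 0 ∧ (Matrix.of ![v, y 0, y 1, y 2]).permanent ≠ 0) :
    False := by
  -- `M (y, 0) = (Kl y, lam y)`
  set Kl : (Fin 3 → Fin 4 → K) →ₗ[K] (Fin 3 → Fin 4 → K) :=
    LinearMap.fst K _ K ∘ₗ M ∘ₗ LinearMap.inl K _ K with hKl
  set lam : (Fin 3 → Fin 4 → K) →ₗ[K] K :=
    LinearMap.snd K _ K ∘ₗ M ∘ₗ LinearMap.inl K _ K with hlam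
  have hM : ∀ y, M (y, 0) = (Kl y, lam y) := fun y => rfl
  -- the forms vanish on `(y,0)` at `x = y`
  have h0 : ∀ y, Γ y (y, 0) (y, 0) = 0 := by
    intro y
    have h := hflow y 0 (y, 0) (by rw [zero_smul, add_zero])
    rw [mul_zero, zero_mul] at h
    exact (mul_eq_zero.1 h).resolve_left hδ₀
  -- the exact flow on `ker lam`
  have hfl : ∀ y, lam y = 0 → ∀ t : K,
      (Matrix.of ![v, (y + t • Kl y) 0, (y + t • Kl y) 1, (y + t • Kl y) 2]).permanent =
        (Matrix.of ![v, y 0, y 1, y 2]).permanent := by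
    intro y hy
    set g := Γ (Kl y) (y, 0) (y, 0) with hg
    have hid : ∀ t : K, δ₀ * t * g =
        c * t * ((Matrix.of ![v, y 0, y 1, y 2]).permanent +
          t * ((Matrix.of ![v, Kl y 0, y 1, y 2]).permanent +
            (Matrix.of ![v, y 0, Kl y 1, y 2]).permanent +
            (Matrix.of ![v, y 0, y 1, Kl y 2]).permanent) +
          t ^ 2 * ((Matrix.of ![v, y 0, Kl y 1, Kl y 2]).permanent +
            (Matrix.of ![v, Kl y 0, y 1, Kl y 2]).permanent +
            (Matrix.of ![v, Kl y 0, Kl y 1, y 2]).permanent) +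
          t ^ 3 * (Matrix.of ![v, Kl y 0, Kl y 1, Kl y 2]).permanent) := by
      intro t
      have hu : ((y, (0 : K)) : (Fin 3 → Fin 4 → K) × K) + t • M (y, 0) = (y + t • Kl y, 0) := by
        rw [hM, Prod.smul_mk, Prod.mk_add_mk, hy, smul_zero, add_zero]
      have h := hflow (y + t • Kl y) t (y, 0) hu
      rw [map_add, map_smul, LinearMap.add_apply, LinearMap.smul_apply, LinearMap.add_apply,
        LinearMap.smul_apply, h0, zero_add, smul_eq_mul] at h
      simp only [Pi.add_apply, Pi.smul_apply] at h
      rw [permanent_rows_add_smul] at h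
      linear_combination h
    obtain ⟨h1, h2, h3⟩ := cubic_coeffs_eq_zero hc hid
    intro t
    simp only [Pi.add_apply, Pi.smul_apply]
    rw [permanent_rows_add_smul, h1, h2, h3]
    ring
  -- a good point, and (E1) there
  obtain ⟨y, hy, hKy, hFy⟩ := hrig Kl lam hfl
  have h := hE1 y
  rw [hM, hKy, hy, Prod.mk_zero_zero, map_zero, LinearMap.zero_apply, mul_zero] at h
  exact hFy (by
    have h' : c * (Matrix.of ![v, y 0, y 1, y 2]).permanent = 0 := by linear_combination h
    exact (mul_eq_zero.1 h').resolve_left hc)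

end Summit.ValiantsHypothesis.ValiantsHypothesis.Theorems.SymPencilPerFourOneRowDefectTwoEndgame

end
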